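import Literature.Geometry.Riemannian.EnergySecondVariation
import Literature.Geometry.Lorentzian.GeodesicProofs
import Literature.Geometry.Riemannian.EellsSampson
import HarnessLib

/-!
# Second variation of the energy, II: the integrated formula; stability of harmonic maps into
# nonpositively curved targets (topic `Geometry/Riemannian`)

The sequel of `EnergySecondVariation.lean`. For a `C^∞` deformation `F : ℝ × M → N` of maps of a
compact Riemannian manifold without boundary `(M, g)` (modelled on `ℝ^m`) into a manifold with a
`C^∞` (pseudo-)Riemannian metric `h`, with variation field `V = ∂ₜF(t₀, ·)`, acceleration field
`a = D_t∂ₜF(t₀, ·)` and `φ = F_{t₀}`, we PROVE the **second-variation formula**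
(Eells–Sampson 1964, §3; Eells–Lemaire 1983, §3; R. T. Smith 1975):

  `d²/dt²|_{t₀} E(F_t) = ∫_M ( ∑ᵢⱼ (𝒢⁻¹)ⱼᵢ [h(D_{sᵢ}V, D_{sⱼ}V) + h(R(V, dφ sᵢ)V, dφ sⱼ)] − h(a, τ(φ)) ) dμ_g`

(`hasDerivAt_deriv_energy_stage_eq`; in classical notation
`∫ (|∇V|² − ⟨R^N(dφ eᵢ, V)V, dφ eᵢ⟩ + ⟨∇_{∂ₜ}∂ₜF, ∇^*dφ⟩)`), and its consequences:

* `hasDerivAt_deriv_energy_stage_of_tensionField_eq_zero` — at a stage with `τ ≡ 0` (a harmonic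
  map) the acceleration term drops out;
* `second_variation_integrand_nonneg` — for `h` Riemannian of nonpositive sectional curvature
  (`HasNonposSectionalCurvature`, the hypothesis of `eellsSampson_existence`) the integrand is
  pointwise `≥ 0` (metric trace of a form with diagonal `|D_uV|² − Rm(V, dφu, dφu, V)`);
* `deriv_deriv_energy_nonneg_of_isHarmonicMap` — **harmonic maps of closed manifolds into
  nonpositively curved targets are weakly stable**: `d²/dt²|₀ E(F_t) ≥ 0` for every smooth
  deformation (Eells–Sampson 1964, §3; Hartman 1967).

Ingredients proved here: `contMDiffAt_lift_velocity_family`,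
`contMDiffAt_lift_covariantDerivAlong_family` (the covariant time-derivative of a smooth field
along a family of curves read in a normed parameter space has a smooth lift — frame formula and
frame independence), `contMDiff_lift_acceleration_stage` (the acceleration field is a smooth
field along the stage), `hasDerivAt_deriv_energyDensity_stage_eq` (the pointwise second variation
in divergence form, via the dual field of `a` and `EnergyFirstVariation.lean`),
`contMDiff_deriv_time`, `hasDerivAt_integral_family` (calculus on `M × ℝ`), and the divergence
theorem `integral_vectorDivergence_eq_zero`. Everything is proved; no definitions, no named facts.

## References

* J. Eells, J. H. Sampson, *Harmonic mappings of Riemannian manifolds*, Amer. J. Math. 86 (1964),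
  §3. [EellsSampson1964]
* B. O'Neill, *Semi-Riemannian Geometry* (1983), Ch. 3, Prop. 3.18, Prop. 3.36; Ch. 4, p. 123,
  Prop. 44. [ONeill1983]
* J. Eells, A. Ratto, *Harmonic Maps and Minimal Immersions with Symmetries* (1993), Ch. I (1.9).
  [EellsRatto1993]
-/

noncomputable section

open Bundle Set Function Filter
open scoped Manifold ContDiff Topology

namespace Literature.Geometry.Riemannian

open Lorentzian Lorentzian.PseudoRiemannianMetric

namespace HarmonicMap

variable {EM : Type*} [NormedAddCommGroup EM] [NormedSpace ℝ EM] [FiniteDimensional ℝ EM]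
  {HM : Type*} [TopologicalSpace HM] {IM : ModelWithCorners ℝ EM HM} [IM.Boundaryless]
  {M : Type*} [TopologicalSpace M] [ChartedSpace HM M] [IsManifold IM ∞ M]
  {EN : Type*} [NormedAddCommGroup EN] [NormedSpace ℝ EN] [FiniteDimensional ℝ EN]
  [CompleteSpace EN] {HN : Type*} [TopologicalSpace HN] {IN : ModelWithCorners ℝ EN HN}
  {N : Type*} [TopologicalSpace N] [ChartedSpace HN N] [IsManifold IN ∞ N]

variable (h : PseudoRiemannianMetric IN ∞ EN (TangentSpace IN : N → Type _)) [h.HasLeviCivita]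

/-! ### `D_t` of a smooth field along a family of curves read in a normed parameter space -/

omit [FiniteDimensional ℝ EM] [IM.Boundaryless] [IsManifold IM ∞ M] [FiniteDimensional ℝ EN]
  [CompleteSpace EN] [h.HasLeviCivita] in
/-- **The time velocity of a smooth family of curves read in a normed parameter space has a
smooth lift**: for `P : ℝ × EM → N` `C^∞` on an open set `D`, `q ↦ (P q, ∂ₜ|_{q.1} P(·, q.2))`
is `C^∞` at every `q ∈ D` (`contMDiffAt_lift_mfderiv_const'` on the vector `(1, 0)` and
`velocity_eq_mfderiv_chart`). [folklore] -/
theorem contMDiffAt_lift_velocity_family {P : ℝ × EM → N} {D : Set (ℝ × EM)}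
    (hD : IsOpen D) (hP : ContMDiffOn 𝓘(ℝ, ℝ × EM) IN ∞ P D) {q₀ : ℝ × EM} (hq₀ : q₀ ∈ D) :
    ContMDiffAt 𝓘(ℝ, ℝ × EM) IN.tangent ∞ (fun q : ℝ × EM ↦ (TotalSpace.mk' EN (P q)
      (velocity IN (fun t' ↦ P (t', q.2)) q.1) : TangentBundle IN N)) q₀ := by
  have hL := contMDiffAt_lift_mfderiv_const' (IN := IN) hD hP hq₀ ((1 : ℝ), (0 : EM))
  refine hL.congr_of_eventuallyEq ?_
  filter_upwards [hD.mem_nhds hq₀] with q hq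
  have hPd : MDifferentiableAt 𝓘(ℝ, ℝ × EM) IN P q :=
    (hP.contMDiffAt (hD.mem_nhds hq)).mdifferentiableAt (by simp)
  have := velocity_eq_mfderiv_chart (P := P) (t := q.1) (u := q.2) hPd
  show (TotalSpace.mk' EN (P q) (velocity IN (fun t' ↦ P (t', q.2)) q.1) : TangentBundle IN N) =
    TotalSpace.mk' EN (P q) (mfderiv 𝓘(ℝ, ℝ × EM) IN P q ((1 : ℝ), (0 : EM)))
  congr 1

omit [FiniteDimensional ℝ EM] [IM.Boundaryless] [IsManifold IM ∞ M] in
/-- **The covariant time-derivative of a smooth field along a smooth family of curves is smooth,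
jointly in time and parameter** — parameter space a normed space `EM`, family `t ↦ P (t, u)`
for `P : ℝ × EM → N` `C^∞` on an open set `D`, field `W` along `P` with `C^∞` lift on `D`: the
lift `q = (t, u) ↦ (P q, D_t W(·, u)|_t) ∈ TN` is `C^∞` at every point of `D`. In the fixed frame
`sᵢ` of `TN` at `P q₀` (frame independence, `covariantDerivAlongFrame_eq_holds`),
`D_t W = ∑ᵢ ∂ₜcⁱ sᵢ(P) + ∑ᵢ cⁱ ∇_{Pₜ} sᵢ` with `cⁱ(q)` the frame coefficients of the lift
(`contMDiffAt_localFrame_coeff_lift`), `∂ₜcⁱ` `C^∞` by `ContDiffAt.fderiv`, and `∇_{Pₜ} sᵢ`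
a smooth `End(TN)`-section applied to the smooth lift `(P, Pₜ)`
(`contMDiffAt_lift_mfderiv_const'`). O'Neill 1983, Ch. 3, Prop. 3.18 and Ch. 4, p. 123.
[cite: ONeill1983, Ch. 4, p. 123] -/
theorem contMDiffAt_lift_covariantDerivAlong_family {P : ℝ × EM → N} {D : Set (ℝ × EM)}
    (hD : IsOpen D) (hP : ContMDiffOn 𝓘(ℝ, ℝ × EM) IN ∞ P D)
    {W : Π q : ℝ × EM, TangentSpace IN (P q)}
    (hW : ∀ q ∈ D, ContMDiffAt 𝓘(ℝ, ℝ × EM) IN.tangent ∞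
      (fun q ↦ (TotalSpace.mk' EN (P q) (W q) : TangentBundle IN N)) q)
    {q₀ : ℝ × EM} (hq₀ : q₀ ∈ D) :
    ContMDiffAt 𝓘(ℝ, ℝ × EM) IN.tangent ∞ (fun q : ℝ × EM ↦ (TotalSpace.mk' EN (P q)
      (covariantDerivAlong h.leviCivita (fun t' ↦ P (t', q.2)) (fun t' ↦ W (t', q.2)) q.1) :
        TangentBundle IN N)) q₀ := by
  classical
  set x₁ := P q₀ with hx₁
  set e₁ := trivializationAt EN (TangentSpace IN : N → Type _) x₁ with he₁
  set bN := Module.finBasis ℝ EN with hbN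
  have htop : (((⊤ : ℕ∞) : ℕ∞ω)) = ∞ := rfl
  have hinf : h.leviCivita.IsLocallyContMDiff (⊤ : ℕ∞) := h.isLocallyContMDiff_leviCivita_holds ⊤ (by simp)
  have hPq₀ : ContMDiffAt 𝓘(ℝ, ℝ × EM) IN ∞ P q₀ := hP.contMDiffAt (hD.mem_nhds hq₀)
  -- the neighbourhood `D₁ = D ∩ P⁻¹(base set)` of `q₀`
  set D₁ : Set (ℝ × EM) := D ∩ P ⁻¹' e₁.baseSet with hD₁
  have hD₁o : IsOpen D₁ := hP.continuousOn.isOpen_inter_preimage hD e₁.open_baseSet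
  have hq₀D₁ : q₀ ∈ D₁ := by
    refine ⟨hq₀, ?_⟩
    show P q₀ ∈ e₁.baseSet
    exact FiberBundle.mem_baseSet_trivializationAt' x₁
  have hnear : ∀ᶠ q in 𝓝 q₀, q ∈ D₁ := hD₁o.mem_nhds hq₀D₁
  -- frame coefficients of the lift, smooth on `D₁`
  set c : Fin (Module.finrank ℝ EN) → ℝ × EM → ℝ := fun i q ↦ e₁.localFrame_coeff IN bN i (P q) (W q)
    with hc
  have hcs : ∀ i, ∀ q ∈ D₁, ContMDiffAt 𝓘(ℝ, ℝ × EM) 𝓘(ℝ, ℝ) ∞ (c i) q := fun i q hq ↦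
    contMDiffAt_localFrame_coeff_lift bN e₁ hq.2 (hW q hq.1) i
  have hcs' : ∀ i, ∀ q ∈ D₁, ContDiffAt ℝ ∞ (c i) q := fun i q hq ↦
    contMDiffAt_iff_contDiffAt.1 (hcs i q hq)
  -- their partial time derivatives are smooth at `q₀`
  have hdc : ∀ i, ContDiffAt ℝ ∞ (fun q : ℝ × EM ↦ deriv (fun t' ↦ c i (t', q.2)) q.1) q₀ := by
    intro i
    have hF : ContDiffAt ℝ ∞ (uncurry fun (q : ℝ × EM) (t' : ℝ) ↦ c i (t', q.2)) (q₀, q₀.1) := by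
      have hlin : ContDiff ℝ ∞ (fun z : (ℝ × EM) × ℝ ↦ ((z.2, z.1.2) : ℝ × EM)) :=
        contDiff_snd.prodMk (contDiff_snd.comp contDiff_fst)
      have := (hcs' i q₀ hq₀D₁).comp (q₀, q₀.1) hlin.contDiffAt
      exact this
    have h1 : ContDiffAt ℝ ∞ (fun q : ℝ × EM ↦ fderiv ℝ (fun t' ↦ c i (t', q.2)) q.1) q₀ :=
      ContDiffAt.fderiv (f := fun (q : ℝ × EM) (t' : ℝ) ↦ c i (t', q.2)) (g := fun q : ℝ × EM ↦ q.1)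
        hF contDiffAt_fst (by exact_mod_cast (le_top : (⊤ : ℕ∞) + 1 ≤ ⊤))
    have h2 := h1.clm_apply contDiffAt_const (g := fun _ ↦ (1 : ℝ))
    exact h2.congr_of_eventuallyEq (Eventually.of_forall fun q ↦ (fderiv_apply_one_eq_deriv).symm)
  -- the frame fields and their covariant derivatives, along `P`
  have hframe : ∀ i, ContMDiffAt 𝓘(ℝ, ℝ × EM) IN.tangent ∞
      (fun q ↦ (TotalSpace.mk' EN (P q) (e₁.localFrame bN i (P q)) : TangentBundle IN N)) q₀ :=
    fun i ↦ (contMDiffAt_localFrame_of_mem ∞ e₁ bN i hq₀D₁.2).comp q₀ hPq₀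
  have hvel : ContMDiffAt 𝓘(ℝ, ℝ × EM) IN.tangent ∞ (fun q : ℝ × EM ↦ (TotalSpace.mk' EN (P q)
      (velocity IN (fun t' ↦ P (t', q.2)) q.1) : TangentBundle IN N)) q₀ :=
    contMDiffAt_lift_velocity_family hD hP hq₀
  have hcovterm : ∀ i, ContMDiffAt 𝓘(ℝ, ℝ × EM) IN.tangent ∞ (fun q : ℝ × EM ↦ (TotalSpace.mk' EN (P q)
      (h.leviCivita (e₁.localFrame bN i) (P q) (velocity IN (fun t' ↦ P (t', q.2)) q.1)) :
        TangentBundle IN N)) q₀ := by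
    intro i
    have ht : CMDiff[e₁.baseSet] ∞ (T% (e₁.localFrame bN i)) := fun y hy ↦
      (contMDiffAt_localFrame_of_mem ∞ e₁ bN i hy).contMDiffWithinAt
    have hDt : ContMDiffOn IN (IN.prod 𝓘(ℝ, EN →L[ℝ] EN)) ∞
        (h.leviCivita.totalCovDeriv (e₁.localFrame bN i)) e₁.baseSet :=
      (hinf e₁.baseSet e₁.open_baseSet).contMDiff (by simpa [htop] using ht)
    have hDq : ContMDiffAt 𝓘(ℝ, ℝ × EM) (IN.prod 𝓘(ℝ, EN →L[ℝ] EN)) ∞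
        (fun q ↦ h.leviCivita.totalCovDeriv (e₁.localFrame bN i) (P q)) q₀ :=
      ((hDt).contMDiffAt (e₁.open_baseSet.mem_nhds hq₀D₁.2)).comp q₀ hPq₀
    exact ContMDiffAt.clm_bundle_apply (b := P) hDq hvel
  -- the assembled frame formula is smooth at `q₀`
  have hrhs : ContMDiffAt 𝓘(ℝ, ℝ × EM) IN.tangent ∞ (fun q : ℝ × EM ↦ (TotalSpace.mk' EN (P q)
      (∑ i, deriv (fun t' ↦ c i (t', q.2)) q.1 • e₁.localFrame bN i (P q) +
        ∑ i, c i q • h.leviCivita (e₁.localFrame bN i) (P q) (velocity IN (fun t' ↦ P (t', q.2)) q.1)) :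
        TangentBundle IN N)) q₀ := by
    refine contMDiffAt_lift_add (contMDiffAt_lift_sum _ hPq₀ fun i _ ↦ ?_)
      (contMDiffAt_lift_sum _ hPq₀ fun i _ ↦ ?_)
    · exact contMDiffAt_lift_smul (hframe i) (contMDiffAt_iff_contDiffAt.2 (hdc i))
    · exact contMDiffAt_lift_smul (hcovterm i) (hcs i q₀ hq₀D₁)
  -- and agrees with the lift of `D_t W` near `q₀` (frame independence)
  refine hrhs.congr_of_eventuallyEq ?_
  filter_upwards [hnear] with q hq
  have hWt : MDifferentiableAt 𝓘(ℝ, ℝ) IN.tangent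
      (fun t' ↦ (TotalSpace.mk' EN (P (t', q.2)) (W (t', q.2)) : TangentBundle IN N)) q.1 := by
    have hline : ContMDiff 𝓘(ℝ, ℝ) 𝓘(ℝ, ℝ × EM) ∞ (fun t' : ℝ ↦ ((t', q.2) : ℝ × EM)) :=
      contMDiff_id.prodMk_space contMDiff_const
    exact ((hW q hq.1).comp q.1 (hline q.1)).mdifferentiableAt (by simp)
  have hfr := covariantDerivAlongFrame_eq_holds (cov := h.leviCivita) e₁ bN
    (γ := fun t' ↦ P (t', q.2)) (W := fun t' ↦ W (t', q.2)) (t₀ := q.1) hq.2 hWt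
  rw [← hfr, covariantDerivAlongFrame]

/-! ### The acceleration field of a deformation is a smooth field along each stage -/

variable {F : ℝ → M → N} (hF : ContMDiff (𝓘(ℝ, ℝ).prod IM) IN ∞ (fun p : ℝ × M ↦ F p.1 p.2))

include hF in
omit [FiniteDimensional ℝ EM] in
/-- **The acceleration field `a = D_t∂ₜF(t₀, ·)` of a smooth deformation is a smooth field along
the stage `F t₀`**: the lift `y ↦ (F t₀ y, D_t ∂ₜF (t₀, y)) ∈ TN` is `C^∞`. With the family read
in the chart `φ` of `M` at `y₀`, `P(t, u) = F t (φ⁻¹ u)` (`contMDiffOn_chartFamily`), it is the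
lift of `contMDiffAt_lift_covariantDerivAlong_family` for the time-velocity field of `P`
composed with `y ↦ (t₀, φ y)`. O'Neill 1983, Ch. 4, p. 123. [cite: ONeill1983, Ch. 4, p. 123] -/
theorem contMDiff_lift_acceleration_stage (t₀ : ℝ) :
    ContMDiff IM IN.tangent ∞ (fun y ↦ (TotalSpace.mk' EN (F t₀ y)
      (covariantDerivAlong h.leviCivita (fun t' ↦ F t' y)
        (fun t' ↦ velocity IN (fun t ↦ F t y) t') t₀) : TangentBundle IN N)) := by
  intro y₀
  set φ := extChartAt IM y₀ with hφ
  set D : Set (ℝ × EM) := (univ : Set ℝ) ×ˢ φ.target with hD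
  have hDo : IsOpen D := isOpen_univ.prod (isOpen_extChartAt_target y₀)
  set P : ℝ × EM → N := fun q ↦ F q.1 (φ.symm q.2) with hP
  have hPs : ContMDiffOn 𝓘(ℝ, ℝ × EM) IN ∞ P D := contMDiffOn_chartFamily hF y₀
  have hW : ∀ q ∈ D, ContMDiffAt 𝓘(ℝ, ℝ × EM) IN.tangent ∞ (fun q : ℝ × EM ↦ (TotalSpace.mk' EN
      (P q) (velocity IN (fun t' ↦ P (t', q.2)) q.1) : TangentBundle IN N)) q := fun q hq ↦
    contMDiffAt_lift_velocity_family hDo hPs hq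
  set ψ : M → ℝ × EM := fun y ↦ (t₀, φ y) with hψ
  have hψs : ContMDiffOn IM 𝓘(ℝ, ℝ × EM) ∞ ψ (chartAt HM y₀).source := fun y hy ↦
    contMDiffWithinAt_const.prodMk_space
      ((contMDiffOn_extChartAt (I := IM) (n := ∞) (x := y₀)) y hy)
  have hy₀ : y₀ ∈ (chartAt HM y₀).source := mem_chart_source HM y₀
  have hq : ψ y₀ ∈ D := ⟨mem_univ _, φ.map_source (mem_extChartAt_source y₀)⟩
  have hL := contMDiffAt_lift_covariantDerivAlong_family h hDo hPs
    (W := fun q ↦ velocity IN (fun t' ↦ P (t', q.2)) q.1) hW hq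
  have hcomp := hL.comp y₀ ((hψs y₀ hy₀).contMDiffAt ((chartAt HM y₀).open_source.mem_nhds hy₀))
  refine hcomp.congr_of_eventuallyEq ?_
  filter_upwards [(chartAt HM y₀).open_source.mem_nhds hy₀] with y hy
  have hys : y ∈ φ.source := by simpa [hφ] using hy
  have hback : φ.symm (φ y) = y := φ.left_inv hys
  have hfun : (fun t ↦ F t y) = fun t' ↦ P (t', φ y) := by
    funext t
    simp only [hP, hback]
  have hlift := congrArg (fun (c : ℝ → N) ↦ fun t' ↦
    (TotalSpace.mk' EN (c t') (velocity IN c t') : TangentBundle IN N)) hfun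
  have hval := covariantDerivAlong_congr_lift h hlift t₀
  have key : ∀ (b₁ b₂ : N), b₁ = b₂ → ∀ (v₁ : TangentSpace IN b₁) (v₂ : TangentSpace IN b₂),
      (v₁ : EN) = v₂ → (TotalSpace.mk' EN b₁ v₁ : TangentBundle IN N) = TotalSpace.mk' EN b₂ v₂ := by
    rintro b₁ _ rfl v₁ v₂ hv
    rw [show v₁ = v₂ from hv]
  exact key _ _ (by simp only [hP, hψ, hback]) _ _ hval

/-! ### The pointwise second variation in divergence form -/

section Pointwise

variable [CompleteSpace EM] (g : ContMDiffRiemannianMetric IM ∞ EM (TangentSpace IM : M → Type _))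
  [(ofRiemannian g).HasLeviCivita]

include hF in
/-- **The second time-derivative of the energy density, divergence form** (the pointwise content
of the second-variation formula; Eells–Lemaire 1983, §3; Smith 1975): with `V = ∂ₜF(t₀, ·)`,
`a = D_t∂ₜF(t₀, ·)` along `φ = F_{t₀}`, `Y_a = (h(a, dφ ·))^♯` the dual field of the
acceleration and `sᵢ`, `𝒢⁻¹` the canonical frame data at `x`,
`d²/dt²|_{t₀} e(F_t)(x) = div Y_a (x) − h(a, τ(φ))(x)
  + ∑ᵢⱼ (𝒢⁻¹)ⱼᵢ [h(D_{sᵢ}V, D_{sⱼ}V) + h(R(V, dφ sᵢ)V, dφ sⱼ)]`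
(`hasDerivAt_deriv_energyDensity_stage` symmetrised, the divergence of the dual field
`vectorDivergence_varDual_eq_sum` for the field `a` — smooth by `contMDiff_lift_acceleration_stage` —
and `τ = ∑ (𝒢⁻¹)ₖₗ ∇dφ(sₖ, sₗ)`). [cite: EellsSampson1964, §3] [cite: ONeill1983, Ch. 4, Prop. 44 (2)] -/
theorem hasDerivAt_deriv_energyDensity_stage_eq (x : M) (t₀ : ℝ) :
    HasDerivAt (fun t ↦ deriv (fun s ↦ energyDensity g h (F s) x) t)
      ((ofRiemannian g).vectorDivergence (fun y : M ↦ (ofRiemannian g).sharp y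
          (((h.val (F t₀ y) (covariantDerivAlong h.leviCivita (fun t' ↦ F t' y)
              (fun t' ↦ velocity IN (fun t ↦ F t y) t') t₀)).comp (mfderiv IM IN (F t₀) y) :
            TangentSpace IM y →L[ℝ] ℝ) : TangentSpace IM y →ₗ[ℝ] ℝ)) x -
        h.val (F t₀ x) (covariantDerivAlong h.leviCivita (fun t' ↦ F t' x)
          (fun t' ↦ velocity IN (fun t ↦ F t x) t') t₀) (tensionField g h (F t₀) x) +
        ∑ i, ∑ j, (Matrix.of fun i j ↦ (ofRiemannian g).val x
            ((trivializationAt EM (TangentSpace IM : M → Type _) x).localFrame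
              (Module.finBasis ℝ EM) i x)
            ((trivializationAt EM (TangentSpace IM : M → Type _) x).localFrame
              (Module.finBasis ℝ EM) j x))⁻¹ j i *
          (h.val (F t₀ x)
              (h.normalDerivAlong (F t₀) (fun y ↦ velocity IN (fun t ↦ F t y) t₀) x
                ((trivializationAt EM (TangentSpace IM : M → Type _) x).localFrame
                  (Module.finBasis ℝ EM) i x))
              (h.normalDerivAlong (F t₀) (fun y ↦ velocity IN (fun t ↦ F t y) t₀) x
                ((trivializationAt EM (TangentSpace IM : M → Type _) x).localFrame
                  (Module.finBasis ℝ EM) j x)) +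
            h.val (F t₀ x)
              (h.leviCivita.curvature (F t₀ x) (velocity IN (fun t ↦ F t x) t₀)
                (mfderiv IM IN (F t₀) x ((trivializationAt EM (TangentSpace IM : M → Type _)
                  x).localFrame (Module.finBasis ℝ EM) i x)) (velocity IN (fun t ↦ F t x) t₀))
              (mfderiv IM IN (F t₀) x ((trivializationAt EM (TangentSpace IM : M → Type _)
                x).localFrame (Module.finBasis ℝ EM) j x)))) t₀ := by
  classical
  -- abbreviations
  set fr : Fin (Module.finrank ℝ EM) → TangentSpace IM x := fun i ↦
    (trivializationAt EM (TangentSpace IM : M → Type _) x).localFrame (Module.finBasis ℝ EM) i x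
    with hfr
  set Ginv : Matrix (Fin (Module.finrank ℝ EM)) (Fin (Module.finrank ℝ EM)) ℝ :=
    (Matrix.of fun i j ↦ (ofRiemannian g).val x
      ((trivializationAt EM (TangentSpace IM : M → Type _) x).localFrame
        (Module.finBasis ℝ EM) i x)
      ((trivializationAt EM (TangentSpace IM : M → Type _) x).localFrame
        (Module.finBasis ℝ EM) j x))⁻¹ with hGinv
  have hGs : ∀ i j, Ginv i j = Ginv j i := fun i j ↦ gramInv_symm g x i j
  set V : Π y : M, TangentSpace IN (F t₀ y) := fun y ↦ velocity IN (fun t ↦ F t y) t₀ with hVdef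
  set acc : Π y : M, TangentSpace IN (F t₀ y) := fun y ↦ covariantDerivAlong h.leviCivita
    (fun t' ↦ F t' y) (fun t' ↦ velocity IN (fun t ↦ F t y) t') t₀ with hacc
  set DV : Fin (Module.finrank ℝ EM) → TangentSpace IN (F t₀ x) := fun i ↦
    h.normalDerivAlong (F t₀) V x (fr i) with hDV
  set Da : Fin (Module.finrank ℝ EM) → TangentSpace IN (F t₀ x) := fun i ↦
    h.normalDerivAlong (F t₀) acc x (fr i) with hDa
  set dφ : Fin (Module.finrank ℝ EM) → TangentSpace IN (F t₀ x) := fun i ↦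
    mfderiv IM IN (F t₀) x (fr i) with hdφ
  set Rc : Fin (Module.finrank ℝ EM) → TangentSpace IN (F t₀ x) := fun i ↦
    h.leviCivita.curvature (F t₀ x) (V x) (dφ i) (V x) with hRc
  set S : Fin (Module.finrank ℝ EM) → Fin (Module.finrank ℝ EM) → TangentSpace IN (F t₀ x) :=
    fun i j ↦ secondFF g h (F t₀) x (fr i)
      ((trivializationAt EM (TangentSpace IM : M → Type _) x).localFrame (Module.finBasis ℝ EM) j)
    with hS
  have hA : ContMDiff IM IN.tangent ∞
      (fun y ↦ (TotalSpace.mk' EN (F t₀ y) (acc y) : TangentBundle IN N)) :=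
    contMDiff_lift_acceleration_stage h hF t₀
  -- the raw second derivative
  have hd := hasDerivAt_deriv_energyDensity_stage h hF g x t₀
  refine hd.congr_deriv ?_
  -- rename the value
  show (1 / 2 : ℝ) * ∑ i, ∑ j, Ginv j i *
      (h.val (F t₀ x) (Da i + Rc i) (dφ j) + 2 * h.val (F t₀ x) (DV i) (DV j) +
        h.val (F t₀ x) (dφ i) (Da j + Rc j)) = _
  -- symmetrisation
  have hsym : (1 / 2 : ℝ) * ∑ i, ∑ j, Ginv j i *
      (h.val (F t₀ x) (Da i + Rc i) (dφ j) + 2 * h.val (F t₀ x) (DV i) (DV j) +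
        h.val (F t₀ x) (dφ i) (Da j + Rc j)) =
      ∑ i, ∑ j, Ginv j i * h.val (F t₀ x) (Da i) (dφ j) +
        ∑ i, ∑ j, Ginv j i * (h.val (F t₀ x) (DV i) (DV j) + h.val (F t₀ x) (Rc i) (dφ j)) := by
    have hswap : ∑ i, ∑ j, Ginv j i * h.val (F t₀ x) (dφ i) (Da j + Rc j) =
        ∑ i, ∑ j, Ginv j i * h.val (F t₀ x) (Da i + Rc i) (dφ j) := by
      rw [Finset.sum_comm]
      refine Finset.sum_congr rfl fun i _ ↦ Finset.sum_congr rfl fun j _ ↦ ?_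
      rw [hGs i j, h.symm (F t₀ x) (dφ j) (Da i + Rc i)]
    have h2sum : ∑ i, ∑ j, Ginv j i * (2 * h.val (F t₀ x) (DV i) (DV j)) =
        2 * ∑ i, ∑ j, Ginv j i * h.val (F t₀ x) (DV i) (DV j) := by
      rw [Finset.mul_sum]
      refine Finset.sum_congr rfl fun i _ ↦ ?_
      rw [Finset.mul_sum]
      refine Finset.sum_congr rfl fun j _ ↦ ?_
      ring
    have step1 : (1 / 2 : ℝ) * ∑ i, ∑ j, Ginv j i *
        (h.val (F t₀ x) (Da i + Rc i) (dφ j) + 2 * h.val (F t₀ x) (DV i) (DV j) +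
          h.val (F t₀ x) (dφ i) (Da j + Rc j)) =
        (1 / 2 : ℝ) * (∑ i, ∑ j, Ginv j i * h.val (F t₀ x) (Da i + Rc i) (dφ j) +
          ∑ i, ∑ j, Ginv j i * (2 * h.val (F t₀ x) (DV i) (DV j)) +
          ∑ i, ∑ j, Ginv j i * h.val (F t₀ x) (dφ i) (Da j + Rc j)) := by
      simp only [mul_add, Finset.sum_add_distrib]
    rw [step1, hswap, h2sum]
    simp only [map_add, add_apply, mul_add, Finset.sum_add_distrib]
    ring
  -- the divergence of the dual field of the acceleration
  have h2 := vectorDivergence_varDual_eq_sum h g (contMDiff_stage hF t₀) hA x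
  have h3 : h.val (F t₀ x) (acc x) (tensionField g h (F t₀) x) =
      ∑ i, ∑ j, Ginv j i * h.val (F t₀ x) (acc x) (S i j) := by
    rw [tensionField_eq]
    simp only [map_sum, map_smul, smul_eq_mul]
    refine Finset.sum_congr rfl fun i _ ↦ Finset.sum_congr rfl fun j _ ↦ ?_
    rw [hGs j i]
  rw [hsym, h2, h3]
  simp only [mul_add, Finset.sum_add_distrib]
  ring

end Pointwise

/-! ### Calculus on `M × ℝ`: smooth time derivatives and differentiation under the integral -/

section Calculus

open MeasureTheory

omit [FiniteDimensional ℝ EM] in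
/-- **The time derivative of a function `C^∞` on `M × ℝ` is `C^∞` on `M × ℝ`** (boundaryless
model): with `û(w, t) = u t (φ⁻¹ w)` the chart representative (`contDiffOn_time_chart`),
`∂ₜu(t, x) = Dû(φ x, t)·(0, 1)` and `Dû` is `C^∞` on the open set `φ.target × ℝ`. [folklore] -/
theorem contMDiff_deriv_time {u : ℝ → M → ℝ}
    (hu : ContMDiff (IM.prod 𝓘(ℝ, ℝ)) 𝓘(ℝ, ℝ) ∞ (fun p : M × ℝ ↦ u p.2 p.1)) :
    ContMDiff (IM.prod 𝓘(ℝ, ℝ)) 𝓘(ℝ, ℝ) ∞ (fun p : M × ℝ ↦ deriv (fun s ↦ u s p.1) p.2) := by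
  rintro ⟨x₀, t₀⟩
  set φ := extChartAt IM x₀ with hφ
  set û : EM × ℝ → ℝ := fun q ↦ u q.2 (φ.symm q.1) with hû_def
  have hu' : ContMDiffOn (IM.prod 𝓘(ℝ, ℝ)) 𝓘(ℝ, ℝ) ((⊤ : ℕ∞) : ℕ∞ω) (fun p : M × ℝ ↦ u p.2 p.1)
      (univ ×ˢ univ) := hu.contMDiffOn
  have hû : ContDiffOn ℝ ((⊤ : ℕ∞) : ℕ∞ω) û (φ.target ×ˢ univ) := contDiffOn_time_chart hu' x₀
  have hO : IsOpen (φ.target ×ˢ (univ : Set ℝ)) := (isOpen_extChartAt_target x₀).prod isOpen_univ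
  have hD : ContDiffOn ℝ ∞ (fderiv ℝ û) (φ.target ×ˢ univ) :=
    hû.fderiv_of_isOpen hO (by exact_mod_cast (le_top : (⊤ : ℕ∞) + 1 ≤ ⊤))
  have hDv : ContDiffOn ℝ ∞ (fun q ↦ fderiv ℝ û q ((0 : EM), (1 : ℝ))) (φ.target ×ˢ univ) :=
    hD.clm_apply contDiffOn_const
  -- the slice derivative is `D û (φ x, t) (0, 1)` on `φ.source × ℝ`
  have hslice : ∀ x ∈ φ.source, ∀ t : ℝ,
      HasDerivAt (fun s ↦ u s x) (fderiv ℝ û (φ x, t) ((0 : EM), (1 : ℝ))) t := by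
    intro x hx t
    have hmem : (φ x, t) ∈ φ.target ×ˢ (univ : Set ℝ) := ⟨φ.map_source hx, mem_univ _⟩
    have hd : HasFDerivAt û (fderiv ℝ û (φ x, t)) (φ x, t) :=
      ((hû.contDiffAt (hO.mem_nhds hmem)).differentiableAt (by simp)).hasFDerivAt
    have hc : HasDerivAt (fun s : ℝ ↦ ((φ x, s) : EM × ℝ)) ((0 : EM), (1 : ℝ)) t :=
      (hasDerivAt_const t (φ x)).prodMk (hasDerivAt_id t)
    have hcomp := hd.comp_hasDerivAt t hc
    have heq : (fun s ↦ u s x) = û ∘ fun s : ℝ ↦ ((φ x, s) : EM × ℝ) := by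
      funext s
      simp only [hû_def, comp_apply, φ.left_inv hx]
    rwa [heq]
  have hagree : ∀ z ∈ φ.source ×ˢ (univ : Set ℝ),
      fderiv ℝ û (φ z.1, z.2) ((0 : EM), (1 : ℝ)) = deriv (fun s ↦ u s z.1) z.2 :=
    fun z hz ↦ ((hslice z.1 hz.1 z.2).deriv).symm
  have hψ : ContMDiffOn (IM.prod 𝓘(ℝ, ℝ)) 𝓘(ℝ, EM × ℝ) ∞ (fun z : M × ℝ ↦ ((φ z.1, z.2) : EM × ℝ))
      ((chartAt HM x₀).source ×ˢ univ) :=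
    ((contMDiffOn_extChartAt (I := IM) (n := ∞) (x := x₀)).comp contMDiffOn_fst
      (fun z hz ↦ hz.1)).prodMk_space contMDiffOn_snd
  have hmaps : MapsTo (fun z : M × ℝ ↦ ((φ z.1, z.2) : EM × ℝ)) ((chartAt HM x₀).source ×ˢ univ)
      (φ.target ×ˢ univ) := fun z hz ↦
    ⟨φ.map_source (by simpa [hφ] using hz.1), mem_univ _⟩
  have hcomp : ContMDiffOn (IM.prod 𝓘(ℝ, ℝ)) 𝓘(ℝ, ℝ) ∞
      (fun z : M × ℝ ↦ fderiv ℝ û (φ z.1, z.2) ((0 : EM), (1 : ℝ))) ((chartAt HM x₀).source ×ˢ univ) :=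
    (contMDiffOn_iff_contDiffOn.2 hDv).comp hψ hmaps
  have hloc : ContMDiffOn (IM.prod 𝓘(ℝ, ℝ)) 𝓘(ℝ, ℝ) ∞
      (fun p : M × ℝ ↦ deriv (fun s ↦ u s p.1) p.2) ((chartAt HM x₀).source ×ˢ univ) :=
    hcomp.congr fun z hz ↦ (hagree z ⟨by simpa [hφ] using hz.1, mem_univ _⟩).symm
  exact hloc.contMDiffAt (((chartAt HM x₀).open_source.prod isOpen_univ).mem_nhds
    ⟨mem_chart_source HM x₀, mem_univ _⟩)

variable [CompactSpace M] [T3Space M] [MeasurableSpace M] [BorelSpace M]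
  (g : ContMDiffRiemannianMetric IM ∞ EM (TangentSpace IM : M → Type _))

omit [IM.Boundaryless] in
/-- **Differentiation under the integral over a compact manifold**: for `u : ℝ → M → ℝ` with
`(x, t) ↦ u t x` of class `C^∞` on `M × ℝ`, `t ↦ ∫_M u t dμ_g` has derivative
`∫_M ∂ₜu(t₀, ·) dμ_g` at every `t₀` (`hasDerivAt_integral_of_dominated_loc_of_deriv_le` with the
uniform bound of the continuous `∂ₜu` on `M × [t₀ − 1, t₀ + 1]`; the general form of
`hasDerivAt_energy_family`). [folklore] -/
theorem hasDerivAt_integral_family [BoundarylessManifold IM M] {u : ℝ → M → ℝ}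
    (hu : ContMDiff (IM.prod 𝓘(ℝ, ℝ)) 𝓘(ℝ, ℝ) ∞ (fun p : M × ℝ ↦ u p.2 p.1)) (t₀ : ℝ) :
    HasDerivAt (fun t ↦ ∫ x, u t x ∂riemannianMeasure g)
      (∫ x, deriv (fun s ↦ u s x) t₀ ∂riemannianMeasure g) t₀ := by
  haveI := isFiniteMeasure_riemannianMeasure' g
  have hUc : Continuous fun q : M × ℝ ↦ u q.2 q.1 := hu.continuous
  have hDc : Continuous fun z : M × ℝ ↦ deriv (fun s ↦ u s z.1) z.2 := continuous_deriv_time hu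
  have hslice : ∀ t, Continuous fun x ↦ u t x := fun t ↦ hUc.curry_left (y := t)
  have hDslice : ∀ t, Continuous fun x ↦ deriv (fun s ↦ u s x) t := fun t ↦
    hDc.curry_left (y := t)
  have hK : IsCompact ((univ : Set M) ×ˢ Icc (t₀ - 1) (t₀ + 1)) := isCompact_univ.prod isCompact_Icc
  obtain ⟨C, hC⟩ := hK.exists_bound_of_continuousOn hDc.continuousOn
  obtain ⟨C₀, hC₀⟩ := (isCompact_univ (X := M)).exists_bound_of_continuousOn (hslice t₀).continuousOn
  have hball : ∀ t ∈ Metric.ball t₀ 1, t ∈ Icc (t₀ - 1) (t₀ + 1) := fun t ht ↦ by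
    rw [Metric.mem_ball, Real.dist_eq] at ht
    constructor <;> linarith [abs_lt.1 ht]
  have hint : Integrable (fun x ↦ u t₀ x) (riemannianMeasure g) :=
    (integrable_const C₀).mono' (hslice t₀).aestronglyMeasurable
      (Eventually.of_forall fun x ↦ hC₀ x (mem_univ x))
  have hbound : ∀ᵐ x ∂(riemannianMeasure g), ∀ t ∈ Metric.ball t₀ 1,
      ‖deriv (fun s ↦ u s x) t‖ ≤ C :=
    Eventually.of_forall fun x t ht ↦ hC (x, t) ⟨mem_univ x, hball t ht⟩
  have hdiff : ∀ᵐ x ∂(riemannianMeasure g), ∀ t ∈ Metric.ball t₀ 1,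
      HasDerivAt (fun s ↦ u s x) (deriv (fun s ↦ u s x) t) t :=
    Eventually.of_forall fun x t _ ↦ hasDerivAt_time_slice hu x t
  exact (hasDerivAt_integral_of_dominated_loc_of_deriv_le
    (F := fun t x ↦ u t x) (F' := fun t x ↦ deriv (fun s ↦ u s x) t)
    (Metric.ball_mem_nhds t₀ zero_lt_one)
    (Eventually.of_forall fun t ↦ (hslice t).aestronglyMeasurable) hint
    (hDslice t₀).aestronglyMeasurable hbound (integrable_const C) hdiff).2

end Calculus

/-! ### The second-variation formula on a closed manifold -/

section Integrated

open MeasureTheory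

variable {m : ℕ} {HM₂ : Type*} [TopologicalSpace HM₂]
  {IM₂ : ModelWithCorners ℝ (EuclideanSpace ℝ (Fin m)) HM₂} [IM₂.Boundaryless]
  {M₂ : Type*} [TopologicalSpace M₂] [ChartedSpace HM₂ M₂] [IsManifold IM₂ ∞ M₂]
  [CompactSpace M₂] [T3Space M₂] [MeasurableSpace M₂] [BorelSpace M₂]
  (g : ContMDiffRiemannianMetric IM₂ ∞ (EuclideanSpace ℝ (Fin m)) (TangentSpace IM₂ : M₂ → Type _))
  [(ofRiemannian g).HasLeviCivita]

/-- **The second-variation formula for the energy on a closed manifold** (Eells–Sampson 1964,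
§3; Eells–Lemaire 1983, (3.?); Smith 1975): along a `C^∞` deformation `F` of maps of a compact
Riemannian manifold without boundary (modelled on `ℝ^m`) into `(N, h)`, with `V = ∂ₜF(t₀,·)`,
`a = D_t∂ₜF(t₀,·)`, `φ = F_{t₀}`,
`d²/dt²|_{t₀} E(F_t) = ∫_M ( ∑ᵢⱼ (𝒢⁻¹)ⱼᵢ [h(D_{sᵢ}V, D_{sⱼ}V) + h(R(V, dφ sᵢ)V, dφ sⱼ)] − h(a, τ(φ)) ) dμ_g`
— i.e. `∫ (|∇V|² − ⟨R^N(dφ eᵢ, V)V, dφ eᵢ⟩ − ⟨a, τ(φ)⟩)` — stated for the derivative function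
`t ↦ dE(F_t)/dt`: differentiate under the integral twice (`hasDerivAt_integral_family`,
`contMDiff_deriv_time`), use the pointwise formula `hasDerivAt_deriv_energyDensity_stage_eq` and
the divergence theorem `∫ div Y_a dμ_g = 0` (`integral_vectorDivergence_eq_zero`).
[cite: EellsSampson1964, §3] -/
theorem hasDerivAt_deriv_energy_stage_eq {F : ℝ → M₂ → N}
    (hF : ContMDiff (𝓘(ℝ, ℝ).prod IM₂) IN ∞ (fun p : ℝ × M₂ ↦ F p.1 p.2)) (t₀ : ℝ) :
    HasDerivAt (fun t ↦ deriv (fun s ↦ energy g h (F s)) t)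
      (∫ x, (∑ i, ∑ j, (Matrix.of fun i j ↦ (ofRiemannian g).val x
            ((trivializationAt (EuclideanSpace ℝ (Fin m)) (TangentSpace IM₂ : M₂ → Type _) x).localFrame
              (Module.finBasis ℝ (EuclideanSpace ℝ (Fin m))) i x)
            ((trivializationAt (EuclideanSpace ℝ (Fin m)) (TangentSpace IM₂ : M₂ → Type _) x).localFrame
              (Module.finBasis ℝ (EuclideanSpace ℝ (Fin m))) j x))⁻¹ j i *
          (h.val (F t₀ x)
              (h.normalDerivAlong (F t₀) (fun y ↦ velocity IN (fun t ↦ F t y) t₀) x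
                ((trivializationAt (EuclideanSpace ℝ (Fin m)) (TangentSpace IM₂ : M₂ → Type _) x).localFrame
                  (Module.finBasis ℝ (EuclideanSpace ℝ (Fin m))) i x))
              (h.normalDerivAlong (F t₀) (fun y ↦ velocity IN (fun t ↦ F t y) t₀) x
                ((trivializationAt (EuclideanSpace ℝ (Fin m)) (TangentSpace IM₂ : M₂ → Type _) x).localFrame
                  (Module.finBasis ℝ (EuclideanSpace ℝ (Fin m))) j x)) +
            h.val (F t₀ x)
              (h.leviCivita.curvature (F t₀ x) (velocity IN (fun t ↦ F t x) t₀)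
                (mfderiv IM₂ IN (F t₀) x ((trivializationAt (EuclideanSpace ℝ (Fin m))
                  (TangentSpace IM₂ : M₂ → Type _) x).localFrame
                    (Module.finBasis ℝ (EuclideanSpace ℝ (Fin m))) i x))
                (velocity IN (fun t ↦ F t x) t₀))
              (mfderiv IM₂ IN (F t₀) x ((trivializationAt (EuclideanSpace ℝ (Fin m))
                (TangentSpace IM₂ : M₂ → Type _) x).localFrame
                  (Module.finBasis ℝ (EuclideanSpace ℝ (Fin m))) j x))) -
        h.val (F t₀ x) (covariantDerivAlong h.leviCivita (fun t' ↦ F t' x)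
          (fun t' ↦ velocity IN (fun t ↦ F t x) t') t₀) (tensionField g h (F t₀) x))
        ∂riemannianMeasure g) t₀ := by
  haveI := isFiniteMeasure_riemannianMeasure' g
  -- the first derivative of the energy density, a smooth function on `M × ℝ`
  set u : ℝ → M₂ → ℝ := fun t x ↦ deriv (fun s ↦ energyDensity g h (F s) x) t with hu
  have hus : ContMDiff (IM₂.prod 𝓘(ℝ, ℝ)) 𝓘(ℝ, ℝ) ∞ (fun p : M₂ × ℝ ↦ u p.2 p.1) :=
    contMDiff_deriv_time (contMDiff_energyDensity_family g h hF)
  -- `dE/dt = ∫ u t`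
  have hE : (fun t ↦ deriv (fun s ↦ energy g h (F s)) t) = fun t ↦ ∫ x, u t x ∂riemannianMeasure g :=
    funext fun t ↦ (hasDerivAt_energy_family g h hF t).deriv
  rw [hE]
  have hd := hasDerivAt_integral_family g hus t₀
  -- the second time derivative is continuous in `x`; the divergence of `Y_a` too
  have hu2c : Continuous fun x ↦ deriv (fun s ↦ u s x) t₀ :=
    (continuous_deriv_time hus).curry_left (y := t₀)
  have hA : ContMDiff IM₂ IN.tangent ∞ (fun y ↦ (TotalSpace.mk' EN (F t₀ y)
      (covariantDerivAlong h.leviCivita (fun t' ↦ F t' y) (fun t' ↦ velocity IN (fun t ↦ F t y) t') t₀) :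
        TangentBundle IN N)) := contMDiff_lift_acceleration_stage h hF t₀
  have hY := contMDiff_varDual h g (contMDiff_stage hF t₀) hA
  obtain ⟨hdivc, hdiv0⟩ := integral_vectorDivergence_eq_zero g (hY.of_le (by norm_cast))
  -- the pointwise identity, for every `x`
  have hpt := fun x ↦ (hasDerivAt_deriv_energyDensity_stage_eq h hF g x t₀).deriv
  refine hd.congr_deriv ?_
  -- `∫ ∂ₜu = ∫ div Y_a + ∫ (rest) = ∫ (rest)`
  have hint_u : Integrable (fun x ↦ deriv (fun s ↦ u s x) t₀) (riemannianMeasure g) :=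
    hu2c.integrable_of_hasCompactSupport (isClosed_tsupport _).isCompact
  have hint_div := hdivc.integrable_of_hasCompactSupport (μ := riemannianMeasure g)
    (isClosed_tsupport _).isCompact
  have hrest : Integrable (fun x ↦ deriv (fun s ↦ u s x) t₀ -
      (ofRiemannian g).vectorDivergence (fun y : M₂ ↦ (ofRiemannian g).sharp y
        (((h.val (F t₀ y) (covariantDerivAlong h.leviCivita (fun t' ↦ F t' y)
            (fun t' ↦ velocity IN (fun t ↦ F t y) t') t₀)).comp (mfderiv IM₂ IN (F t₀) y) :
          TangentSpace IM₂ y →L[ℝ] ℝ) : TangentSpace IM₂ y →ₗ[ℝ] ℝ)) x) (riemannianMeasure g) :=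
    hint_u.sub hint_div
  have hsplit := integral_add hint_div hrest
  simp only [add_sub_cancel] at hsplit
  rw [hsplit, hdiv0, zero_add]
  refine integral_congr_ae (Eventually.of_forall fun x ↦ ?_)
  simp only [hu] at hpt ⊢
  rw [hpt x]
  ring

/-- **Second variation at a map with vanishing tension field**: if `τ(F_{t₀}) ≡ 0` (e.g. `F_{t₀}`
harmonic, `tensionField_eq_zero_of_isHarmonicMap`) the acceleration term drops out and
`d²/dt²|_{t₀} E(F_t) = ∫_M ∑ᵢⱼ (𝒢⁻¹)ⱼᵢ [h(D_{sᵢ}V, D_{sⱼ}V) + h(R(V, dφ sᵢ)V, dφ sⱼ)] dμ_g`: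
the second variation depends only on the variation field `V`. Eells–Sampson 1964, §3.
[cite: EellsSampson1964, §3] -/
theorem hasDerivAt_deriv_energy_stage_of_tensionField_eq_zero {F : ℝ → M₂ → N}
    (hF : ContMDiff (𝓘(ℝ, ℝ).prod IM₂) IN ∞ (fun p : ℝ × M₂ ↦ F p.1 p.2)) (t₀ : ℝ)
    (hτ : ∀ x, tensionField g h (F t₀) x = 0) :
    HasDerivAt (fun t ↦ deriv (fun s ↦ energy g h (F s)) t)
      (∫ x, ∑ i, ∑ j, (Matrix.of fun i j ↦ (ofRiemannian g).val x
            ((trivializationAt (EuclideanSpace ℝ (Fin m)) (TangentSpace IM₂ : M₂ → Type _) x).localFrame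
              (Module.finBasis ℝ (EuclideanSpace ℝ (Fin m))) i x)
            ((trivializationAt (EuclideanSpace ℝ (Fin m)) (TangentSpace IM₂ : M₂ → Type _) x).localFrame
              (Module.finBasis ℝ (EuclideanSpace ℝ (Fin m))) j x))⁻¹ j i *
          (h.val (F t₀ x)
              (h.normalDerivAlong (F t₀) (fun y ↦ velocity IN (fun t ↦ F t y) t₀) x
                ((trivializationAt (EuclideanSpace ℝ (Fin m)) (TangentSpace IM₂ : M₂ → Type _) x).localFrame
                  (Module.finBasis ℝ (EuclideanSpace ℝ (Fin m))) i x))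
              (h.normalDerivAlong (F t₀) (fun y ↦ velocity IN (fun t ↦ F t y) t₀) x
                ((trivializationAt (EuclideanSpace ℝ (Fin m)) (TangentSpace IM₂ : M₂ → Type _) x).localFrame
                  (Module.finBasis ℝ (EuclideanSpace ℝ (Fin m))) j x)) +
            h.val (F t₀ x)
              (h.leviCivita.curvature (F t₀ x) (velocity IN (fun t ↦ F t x) t₀)
                (mfderiv IM₂ IN (F t₀) x ((trivializationAt (EuclideanSpace ℝ (Fin m))
                  (TangentSpace IM₂ : M₂ → Type _) x).localFrame
                    (Module.finBasis ℝ (EuclideanSpace ℝ (Fin m))) i x))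
                (velocity IN (fun t ↦ F t x) t₀))
              (mfderiv IM₂ IN (F t₀) x ((trivializationAt (EuclideanSpace ℝ (Fin m))
                (TangentSpace IM₂ : M₂ → Type _) x).localFrame
                  (Module.finBasis ℝ (EuclideanSpace ℝ (Fin m))) j x)))
        ∂riemannianMeasure g) t₀ := by
  have hd := hasDerivAt_deriv_energy_stage_eq h g hF t₀
  simp only [hτ, map_zero, sub_zero] at hd
  exact hd

omit [CompactSpace M₂] [T3Space M₂] [MeasurableSpace M₂] [BorelSpace M₂]
  [(ofRiemannian g).HasLeviCivita] in
/-- **The pointwise second-variation integrand is nonnegative for targets of nonpositive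
curvature**: for `h` Riemannian with nonpositive sectional curvature
(`HasNonposSectionalCurvature`), at every point
`∑ᵢⱼ (𝒢⁻¹)ⱼᵢ [h(D_{sᵢ}V, D_{sⱼ}V) + h(R(V, dφ sᵢ)V, dφ sⱼ)] ≥ 0`: it is the metric trace of the
form `(u, w) ↦ h(D_uV, D_wV) + h(R(V, dφ u)V, dφ w)` whose diagonal is
`|D_uV|² − Rm(V, dφ u, dφ u, V) ≥ 0` (`val_curvature_skew`, `trace_nonneg_of_isRiemannian`).
Eells–Sampson 1964, §3 (the curvature term); Hartman 1967. [cite: EellsSampson1964, §3] -/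
theorem second_variation_integrand_nonneg (hR : h.IsRiemannian) (hK : h.HasNonposSectionalCurvature)
    {F : ℝ → M₂ → N} (hF : ContMDiff (𝓘(ℝ, ℝ).prod IM₂) IN ∞ (fun p : ℝ × M₂ ↦ F p.1 p.2))
    (t₀ : ℝ) (x : M₂) :
    0 ≤ ∑ i, ∑ j, (Matrix.of fun i j ↦ (ofRiemannian g).val x
            ((trivializationAt (EuclideanSpace ℝ (Fin m)) (TangentSpace IM₂ : M₂ → Type _) x).localFrame
              (Module.finBasis ℝ (EuclideanSpace ℝ (Fin m))) i x)
            ((trivializationAt (EuclideanSpace ℝ (Fin m)) (TangentSpace IM₂ : M₂ → Type _) x).localFrame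
              (Module.finBasis ℝ (EuclideanSpace ℝ (Fin m))) j x))⁻¹ j i *
          (h.val (F t₀ x)
              (h.normalDerivAlong (F t₀) (fun y ↦ velocity IN (fun t ↦ F t y) t₀) x
                ((trivializationAt (EuclideanSpace ℝ (Fin m)) (TangentSpace IM₂ : M₂ → Type _) x).localFrame
                  (Module.finBasis ℝ (EuclideanSpace ℝ (Fin m))) i x))
              (h.normalDerivAlong (F t₀) (fun y ↦ velocity IN (fun t ↦ F t y) t₀) x
                ((trivializationAt (EuclideanSpace ℝ (Fin m)) (TangentSpace IM₂ : M₂ → Type _) x).localFrame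
                  (Module.finBasis ℝ (EuclideanSpace ℝ (Fin m))) j x)) +
            h.val (F t₀ x)
              (h.leviCivita.curvature (F t₀ x) (velocity IN (fun t ↦ F t x) t₀)
                (mfderiv IM₂ IN (F t₀) x ((trivializationAt (EuclideanSpace ℝ (Fin m))
                  (TangentSpace IM₂ : M₂ → Type _) x).localFrame
                    (Module.finBasis ℝ (EuclideanSpace ℝ (Fin m))) i x))
                (velocity IN (fun t ↦ F t x) t₀))
              (mfderiv IM₂ IN (F t₀) x ((trivializationAt (EuclideanSpace ℝ (Fin m))
                (TangentSpace IM₂ : M₂ → Type _) x).localFrame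
                  (Module.finBasis ℝ (EuclideanSpace ℝ (Fin m))) j x))) := by
  classical
  haveI : FiniteDimensional ℝ (TangentSpace IM₂ x) :=
    inferInstanceAs (FiniteDimensional ℝ (EuclideanSpace ℝ (Fin m)))
  have hcompat : h.IsCompatible h.leviCivita := (isLeviCivita_leviCivita_holds (g := h)).2
  have hreg : h.leviCivita.IsLocallyContMDiff 1 := h.isLocallyContMDiff_leviCivita_holds 1 (by norm_cast)
  have hx : x ∈ (trivializationAt (EuclideanSpace ℝ (Fin m)) (TangentSpace IM₂ : M₂ → Type _) x).baseSet :=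
    FiberBundle.mem_baseSet_trivializationAt' x
  -- `D_uV` is linear in `u`
  have hVlift : MDifferentiableAt IM₂ IN.tangent (fun y ↦ (TotalSpace.mk' EN (F t₀ y)
      (velocity IN (fun t ↦ F t y) t₀) : TangentBundle IN N)) x :=
    (contMDiff_lift_velocity_stage hF t₀ x).mdifferentiableAt (by simp)
  obtain ⟨A, hA⟩ := exists_normalDerivAlong_eq_clm' h (f := F t₀) BoundarylessManifold.isInteriorPoint hVlift
  -- the curvature endomorphism `u ↦ R(V, dφ u) V`
  set Vx : TangentSpace IN (F t₀ x) := velocity IN (fun t ↦ F t x) t₀ with hVx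
  set dφ : TangentSpace IM₂ x →L[ℝ] TangentSpace IN (F t₀ x) := mfderiv IM₂ IN (F t₀) x with hdφ
  set K : TangentSpace IM₂ x → TangentSpace IN (F t₀ x) := fun u ↦
    h.leviCivita.curvature (F t₀ x) Vx (dφ u) Vx with hK'
  have hKapply : ∀ u, K u = h.leviCivita.curvature (F t₀ x) Vx (dφ u) Vx := fun u ↦ rfl
  have hKadd : ∀ u₁ u₂, K (u₁ + u₂) = K u₁ + K u₂ := fun u₁ u₂ ↦ by
    simp only [hK', map_add, add_apply]
  have hKsmul : ∀ (c : ℝ) u, K (c • u) = c • K u := fun c u ↦ by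
    simp only [hK', map_smul, smul_apply]
  -- the bilinear form
  set B : LinearMap.BilinForm ℝ (TangentSpace IM₂ x) := LinearMap.mk₂ ℝ
    (fun u w ↦ h.val (F t₀ x) (A u) (A w) + h.val (F t₀ x) (K u) (dφ w))
    (fun u₁ u₂ w ↦ by simp only [map_add, hKadd, add_apply]; ring)
    (fun c u w ↦ by simp only [map_smul, hKsmul, smul_apply, smul_eq_mul]; ring)
    (fun u w₁ w₂ ↦ by simp only [map_add]; ring)
    (fun c u w ↦ by simp only [map_smul, smul_eq_mul]; ring) with hB
  have hBapply : ∀ u w, B u w = h.val (F t₀ x) (A u) (A w) + h.val (F t₀ x) (K u) (dφ w) :=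
    fun u w ↦ rfl
  -- its diagonal is nonnegative
  have hdiag : ∀ u, 0 ≤ B u u := by
    intro u
    rw [hBapply, hKapply]
    have h1 : 0 ≤ h.val (F t₀ x) (A u) (A u) := by
      by_cases hu : A u = 0
      · simp [hu]
      · exact (hR _ _ hu).le
    have h2 : 0 ≤ h.val (F t₀ x) (h.leviCivita.curvature (F t₀ x) Vx (dφ u) Vx) (dφ u) := by
      rw [val_curvature_skew hcompat hreg (by norm_cast) (F t₀ x) Vx (dφ u) Vx (dφ u)]
      have := hK h.leviCivita (isLeviCivita_leviCivita_holds (g := h)) (F t₀ x) Vx (dφ u)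
      rw [PseudoRiemannianMetric.curvatureForm] at this
      linarith
    exact add_nonneg h1 h2
  -- the frame sum is the metric trace of `B`
  have htr := trace_eq_sum_gram_inv (ofRiemannian g) x
    ((trivializationAt (EuclideanSpace ℝ (Fin m)) (TangentSpace IM₂ : M₂ → Type _) x).basisAt
      (Module.finBasis ℝ (EuclideanSpace ℝ (Fin m))) hx) B
  simp only [← (trivializationAt (EuclideanSpace ℝ (Fin m)) (TangentSpace IM₂ : M₂ → Type _) x).localFrame_apply_of_mem_baseSet
    (Module.finBasis ℝ (EuclideanSpace ℝ (Fin m))) hx, hBapply, hKapply] at htr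
  have hpos := trace_nonneg_of_isRiemannian (ofRiemannian g) (isRiemannian_ofRiemannian g) x B hdiag
  rw [htr] at hpos
  simp only [hA]
  exact hpos

/-- **Harmonic maps into nonpositively curved targets are weakly stable** (Eells–Sampson 1964,
§3; Hartman 1967): for a `C^∞` deformation `F` of a harmonic map `F₀ : (M, g) → (N, h)` of a
closed Riemannian manifold (modelled on `ℝ^m`) into a compact… (no compactness needed) Riemannian
manifold of nonpositive sectional curvature, `d²/dt²|₀ E(F_t) ≥ 0`. Proof: at a harmonic map
`τ ≡ 0` (`tensionField_eq_zero_of_isHarmonicMap`), so the second variation is the integral of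
the nonnegative integrand `second_variation_integrand_nonneg`. [cite: EellsSampson1964, §3] -/
theorem deriv_deriv_energy_nonneg_of_isHarmonicMap [BoundarylessManifold IN N]
    (hR : h.IsRiemannian) (hK : h.HasNonposSectionalCurvature)
    {F : ℝ → M₂ → N} (hF : ContMDiff (𝓘(ℝ, ℝ).prod IM₂) IN ∞ (fun p : ℝ × M₂ ↦ F p.1 p.2))
    (hharm : IsHarmonicMap g h (F 0)) :
    0 ≤ deriv (fun t ↦ deriv (fun s ↦ energy g h (F s)) t) 0 := by
  have hτ : ∀ x, tensionField g h (F 0) x = 0 := tensionField_eq_zero_of_isHarmonicMap g h hharm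
  rw [(hasDerivAt_deriv_energy_stage_of_tensionField_eq_zero h g hF 0 hτ).deriv]
  exact integral_nonneg fun x ↦ second_variation_integrand_nonneg h g hR hK hF 0 x

end Integrated

end HarmonicMap



end Literature.Geometry.Riemannian

end
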